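import Summits.QuantumFields.YangMills.Theorems.AlphaInputsT3ACv3StartSystemCells
import HarnessLib

/-!
# `AlphaInputsT3ACv3StartSystemBox` — START v3.1 (S5)-4b, file 4: **THE (A3 = hbox) BINDER OF `StartAssembly.dist1_plaqHol_startU_le`** — a constrained, non-deep fine plaquette touching an
# ACTIVE bond of the tube `Q` lies in `Q`'s chart box with all four corners — generically (any quadrant rule `σ` with the two clauses of the LEAD's `quadOf`, any `C` implied by «four
# corners in Ω», ball side abstracted into two hypotheses `hTop`∕`hBot` at INTERIOR cell ends) and the two located facts that drive it: ★ `no_top_overflow` ∕ ★ `no_bot_overflow` (a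
# plaquette straddling a cell end along the edge is unconstrained at a `∂Ω` end — the quadrant rule points at the missing cell — and deep at an interior end — alignment v3.1 (i)) —
# cell `ym3-torus`, width seat `ym-ust-19936-w2` (g2)

WHY ((S5)-4b OF RECORD, OWNER 03:32Z; my hand = hbox∕hcov∕htube).  By `exists_chart_of_tubeActive` an active bond is charted at `w` where `t_Q ≠ s`, i.e. `β ≠ 0`: `|w_μ|, |w_ν| ≤ 2r`
(`betaQB_window`) and one endpoint lies in the quadrant `σ(Q)` (`betaQB_touches`).  A plaquette containing the bond has corners within `2r+1 ≤ Rt` transversally; longitudinally it stays in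
`[−h, h]` unless it straddles the top slice (`w_λ = h`) or the bottom slice (`w_λ = −h`).  Straddling corners lie in `(cellOf Q σQ) ± e_λ` (`…StartSystemCells`); the rule's clauses and
the alignment lemma turn that into «corner ∉ Ω» (contradicting `C`) or «all `2^3` cells at that end in Ω» (then `hTop`∕`hBot`: the plaquette is deep — contradicting `¬Deep`).
WHAT.  §1 helpers (`inTube_mk`, `shift_shift_comm`, `abs_e_le`∕`abs_e_add_e_le`∕`abs_e_sub_e_le`, `corners_of_mem_plaqsIn`, `cellIn_cellOf`, `cellOf_apply_of_not_mem`); §2 ★ `no_top_overflow`, ★ `no_bot_overflow`;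
§3 ★★ `hbox_of_corners` (generic; `d = 3` enters as «every non-transverse direction is `λ`»).  The instance at `quadOf`∕`rT`∕`RtT`∕`FpOf` is a one-line `exact` for the LEAD's knit
(`missingAhead_quadOf`, `missingBehind_quadOf`).
HONEST FRAMING.  Lattice bookkeeping; no analysis.  Count-neutral helper toward the (FL) row of 2′∕2′χ (`--supports stmt-QuantumFields-19936`); (A4 = hsep) is the second hand's; the ball
hypotheses `hTop`∕`hBot` are discharged by the LEAD's ball system; (FL)∕`hLift`, the stub, the crux and the gap are NOT claimed; registry untouched.  YM₃ on T³ is RUNG R3, not Clay.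

References: T. Bałaban, Commun. Math. Phys. 102 (1985) 277–309 [Balaban1985Variational] ((11)–(14) pp.279–280); [Balaban1985UV3] Commun. Math. Phys. 102 (1985) 255–275 ((38)–(39) p.266).
-/

set_option autoImplicit false

noncomputable section

open scoped Matrix.Norms.L2Operator

namespace Summit.QuantumFields.YangMills.Theorems.TubeStart

open Literature.MathematicalPhysics.QuantumFieldTheory.Balaban1983to89
open Literature.MathematicalPhysics.QuantumFieldTheory.Balaban1983to89.T4AdjointCovarianceUnitary (lieSU expSU)
open Literature.MathematicalPhysics.QuantumFieldTheory.Balaban1983to89.BlockAveragingSectionAction (iterSec)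
open Literature.MathematicalPhysics.QuantumFieldTheory.Balaban1983to89.B10Eq38TorusDomains (toFine plaqsIn cornerSet mem_plaqsIn_iff)
open Summit.QuantumFields.Balaban3D.Carriers
open Summit.QuantumFields.YangMills.Theorems.ModelBox
open Summit.QuantumFields.YangMills.Theorems.TubeProfile (betaQB betaQB_touches betaQB_window)

variable {P : Params} {k : ℕ}

/-! ## §1 Helpers -/

/-- Building `InTube` from transverse and longitudinal bounds. [folklore] -/
theorem inTube_mk {μ ν : Fin P.d} {Rt h : ℕ} {v : Fin P.d → ℤ} (hT : ∀ j, (j = μ ∨ j = ν) → |v j| ≤ (Rt : ℤ)) (hL : ∀ j, ¬ (j = μ ∨ j = ν) → |v j| ≤ (h : ℤ)) :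
    InTube μ ν Rt h v := by
  intro j
  by_cases hj : j = μ ∨ j = ν
  · rw [if_pos hj]; exact hT j hj
  · rw [if_neg hj]; exact hL j hj

/-- Shifts commute. [folklore] -/
theorem shift_shift_comm {j : ℕ} (x : Site P j) (a b : Fin P.d) : (x.shift a).shift b = (x.shift b).shift a := by
  funext l
  simp only [Site.shift]
  by_cases hla : l = a
  · subst hla
    by_cases hlb : l = b
    · subst hlb; simp
    · simp [hlb, Ne.symm hlb]
  · by_cases hlb : l = b
    · subst hlb; simp [hla, Ne.symm hla]
    · simp [hla, hlb]

/-- `e_a(j) ∈ {0, 1}` bounds: `|e_a(j)| ≤ 1`. [folklore] -/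
theorem abs_e_le (a j : Fin P.d) : |ModelBox.e a j| ≤ (1 : ℤ) := by
  rw [ModelBox.e, Pi.single_apply]; split_ifs <;> simp

/-- `|e_a(j) + e_b(j)| ≤ 1` for `a ≠ b`. [folklore] -/
theorem abs_e_add_e_le {a b : Fin P.d} (hab : a ≠ b) (j : Fin P.d) : |ModelBox.e a j + ModelBox.e b j| ≤ (1 : ℤ) := by
  rw [ModelBox.e, ModelBox.e, Pi.single_apply, Pi.single_apply]
  by_cases h1 : j = a
  · subst h1; rw [if_pos rfl, if_neg hab]; simp
  · rw [if_neg h1]; split_ifs <;> simp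

/-- `|e_b(j) − e_a(j)| ≤ 1`. [folklore] -/
theorem abs_e_sub_e_le (a b j : Fin P.d) : |ModelBox.e b j - ModelBox.e a j| ≤ (1 : ℤ) := by
  rw [ModelBox.e, ModelBox.e, Pi.single_apply, Pi.single_apply]
  split_ifs <;> simp

/-- The four corners of a plaquette of `plaqsIn 0 Ω` lie in `Ω`. [cite: Balaban1985UV3, p.267] -/
theorem corners_of_mem_plaqsIn {Ω : Set (Site P 0)} {q : Plaq P 0} (hq : q ∈ plaqsIn 0 Ω) :
    q.src ∈ Ω ∧ q.src.shift q.μ ∈ Ω ∧ q.src.shift q.ν ∈ Ω ∧ (q.src.shift q.μ).shift q.ν ∈ Ω := by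
  rw [mem_plaqsIn_iff] at hq
  simpa only [cornerSet, B10Eq38TorusDomains.toFine_zero, Set.insert_subset_iff, Set.singleton_subset_iff] using hq

/-- The four cells of a tube lie in `Ω`. [cite: Balaban1985Variational, (3) p.278] -/
theorem cellIn_cellOf {Ω : Set (Site P 0)} {Q : Plaq P k} (hQ : Q ∈ plaqsIn k Ω) (s : Bool × Bool) : CellIn Ω k (cellOf Q s) := by
  rw [mem_plaqsIn_iff] at hQ
  simp only [cornerSet, Set.insert_subset_iff, Set.singleton_subset_iff] at hQ
  obtain ⟨h1, h2, h3, h4⟩ := hQ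
  obtain ⟨s1, s2⟩ := s
  unfold CellIn cellOf
  cases s1 <;> cases s2 <;> simp only [Bool.false_eq_true, ↓reduceIte]
  · exact h4
  · exact h2
  · exact h3
  · exact h1

/-- Longitudinal coordinates of the quadrant cells are those of `y`. [folklore] -/
theorem cellOf_apply_of_not_mem (Q : Plaq P k) (s : Bool × Bool) {j : Fin P.d} (hj : ¬ (j = Q.μ ∨ j = Q.ν)) : cellOf Q s j = Q.src j := by
  rw [not_or] at hj
  rw [cellOf_apply, if_neg (fun h => hj.1 h.1), if_neg (fun h => hj.2 h.1), add_zero, add_zero]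

/-! ## §2 No overflow at the two ends of the edge -/

section Overflow

variable (hk : k ≤ P.m + P.K) (Ω : Set (Site P 0)) (hsat : ∀ x x' : Site P 0, coarsen k x = coarsen k x' → (x ∈ Ω ↔ x' ∈ Ω))
  (htf : ∀ z : Site P k, coarsen k (toFine k z) = z) (σ : Plaq P k → Bool × Bool) (Q : Plaq P k) (hQ : Q ∈ plaqsIn k Ω)
  {Rt : ℕ} (hRt : Rt + 2 ≤ P.L ^ k) {p : Fin P.d → ℤ} (hp : InTube Q.μ Q.ν Rt (P.L ^ k / 2) p)
  (hside : (if (σ Q).1 then p Q.μ ≤ 0 else 1 ≤ p Q.μ) ∧ (if (σ Q).2 then p Q.ν ≤ 0 else 1 ≤ p Q.ν))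
  {i : Fin P.d} (hi : ¬ (i = Q.μ ∨ i = Q.ν)) (hd3 : ∀ j, ¬ (j = Q.μ ∨ j = Q.ν) → j = i)
include hk hsat htf hQ hRt hp hside hi hd3

omit hQ in
/-- **★ NO CONSTRAINED NON-DEEP PLAQUETTE STRADDLES THE TOP END**: if a quadrant endpoint `p` of an active bond sits on the top slice (`p_λ = ⌊L^k/2⌋`) and `(c + p) + e_λ ∈ Ω`, then
(rule clause A) no quadrant cell has a missing continuation ahead, so all cells at the top vertex are in `Ω` — which the caller's ball hypothesis excludes.
[cite: Balaban1985Variational, (11) p.279; Balaban1985UV3, (39) p.266] -/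
theorem no_top_overflow (hσA : (∃ s, MissingAhead Ω Q s) → MissingAhead Ω Q (σ Q)) (htop : p i = (P.L ^ k / 2 : ℕ))
    (hmem : (boxSite (cornerSite k Q.src Q.μ Q.ν) p).shift i ∈ Ω) (hdeep : (∀ s, CellIn Ω k ((cellOf Q s).shift i)) → False) : False := by
  have hcell : coarsen k ((boxSite (cornerSite k Q.src Q.μ Q.ν) p).shift i) = (cellOf Q (σ Q)).shift i :=
    coarsen_shift_boxSite_top hk Q hRt hp (σ Q) hside.1 hside.2 hi htop
  have hIn : CellIn Ω k ((cellOf Q (σ Q)).shift i) := by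
    rw [← hcell]; exact (mem_iff_cellIn_coarsen Ω hsat htf _).mp hmem
  by_cases hA : ∃ s, MissingAhead Ω Q s
  · obtain ⟨i', hi'μ, hi'ν, hmiss⟩ := hσA hA
    have hii : i' = i := hd3 i' (not_or.mpr ⟨hi'μ, hi'ν⟩)
    rw [hii] at hmiss
    exact hmiss hIn
  · refine hdeep (fun s => ?_)
    by_contra hs
    exact hA ⟨s, i, (not_or.mp hi).1, (not_or.mp hi).2, hs⟩

/-- **★ NO CONSTRAINED NON-DEEP PLAQUETTE STRADDLES THE BOTTOM END**: if a quadrant endpoint `p` sits on the bottom slice (`p_λ = −⌊L^k/2⌋`) and `(c + p) − e_λ ∈ Ω`, then either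
some cell ahead is missing — and ALIGNMENT puts all cells behind in `Ω` — or (rule clause B) no cell behind is missing; both excluded by the caller's ball hypothesis.
[cite: Balaban1985Variational, (11) p.279; Balaban1985UV3, (39) p.266] -/
theorem no_bot_overflow (hk1 : k + 1 ≤ P.m + P.K) (hsat1 : ∀ z z' : Site P k, blockOf z = blockOf z' → (CellIn Ω k z ↔ CellIn Ω k z'))
    (hσB : (¬ ∃ s, MissingAhead Ω Q s) → (∃ s, MissingBehind Ω Q s) → MissingBehind Ω Q (σ Q)) (hbot : p i = -((P.L ^ k / 2 : ℕ) : ℤ))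
    (hmem : unshift (boxSite (cornerSite k Q.src Q.μ Q.ν) p) i ∈ Ω) (hdeep : (∀ s, CellIn Ω k (unshift (cellOf Q s) i)) → False) : False := by
  have hcell : coarsen k (unshift (boxSite (cornerSite k Q.src Q.μ Q.ν) p) i) = unshift (cellOf Q (σ Q)) i :=
    coarsen_unshift_boxSite_bot hk Q hRt hp (σ Q) hside.1 hside.2 hi hbot
  have hIn : CellIn Ω k (unshift (cellOf Q (σ Q)) i) := by
    rw [← hcell]; exact (mem_iff_cellIn_coarsen Ω hsat htf _).mp hmem
  by_cases hA : ∃ s, MissingAhead Ω Q s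
  · -- a missing cell ahead: alignment makes every cell behind present
    obtain ⟨s, i', hi'μ, hi'ν, hmiss⟩ := hA
    have hii : i' = i := hd3 i' (not_or.mpr ⟨hi'μ, hi'ν⟩)
    rw [hii] at hmiss
    refine hdeep (fun s' => ?_)
    exact cellIn_unshift_of_not_cellIn_shift Ω hk1 hsat1 (cellIn_cellOf hQ s) hmiss
      (by rw [cellOf_apply_of_not_mem Q s' hi, cellOf_apply_of_not_mem Q s hi]) (cellIn_cellOf hQ s')
  · by_cases hB : ∃ s, MissingBehind Ω Q s
    · obtain ⟨i', hi'μ, hi'ν, hmiss⟩ := hσB hA hB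
      have hii : i' = i := hd3 i' (not_or.mpr ⟨hi'μ, hi'ν⟩)
      rw [hii] at hmiss
      exact hmiss hIn
    · refine hdeep (fun s => ?_)
      by_contra hs
      exact hB ⟨s, i, (not_or.mp hi).1, (not_or.mp hi).2, hs⟩

end Overflow

/-! ## §3 (A3 = hbox), generic -/

section Box

variable {n : Type*} [Fintype n] [DecidableEq n] [Nonempty n]
variable (σ : Plaq P k → Bool × Bool) (r : ℕ) (V : GaugeField P k (Matrix.specialUnitaryGroup n ℂ)) (Rt : ℕ) (Fp : Plaq P k → lieSU n)
  (IsBall : Site P 0 → Prop) (InBall : Site P 0 → PBond P 0 → Prop) (C : Plaq P 0 → Prop)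

/-- **★★ (A3 = hbox), GENERIC.**  Hypotheses: standing range `k + 1 ≤ m + K`; `Ω` saturated at levels `k` and `k+1`; `C` implies four corners in `Ω`; a unique longitudinal direction
`λ` for every tube (d = 3); the rule `σ` has the two clauses of `quadOf`; radii `2r + 1 ≤ Rt`, `Rt + 2 ≤ L^k`, `2·max(Rt, ⌊L^k/2⌋) + 1 ≤ N₀`; logarithms `expSU F′_Q =` the `V(∂Q)⁻¹`-word
on the tubes; ball hypotheses `hTop`∕`hBot` (a `C`-plaquette straddling an INTERIOR end of a tube is deep).  Conclusion: the (A3) binder for the forms `t_Q = s + β_{r,σ(Q)}` and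
`IsTube := (· ∈ plaqsIn k Ω)`. [cite: Balaban1985Variational, (11)–(14) pp.279–280] -/
theorem hbox_of_corners (hk1 : k + 1 ≤ P.m + P.K) (Ω : Set (Site P 0)) (hsat : ∀ x x' : Site P 0, coarsen k x = coarsen k x' → (x ∈ Ω ↔ x' ∈ Ω))
    (htf : ∀ z : Site P k, coarsen k (toFine k z) = z) (hsat1 : ∀ z z' : Site P k, blockOf z = blockOf z' → (CellIn Ω k z ↔ CellIn Ω k z'))
    (hC : ∀ q, C q → q ∈ plaqsIn 0 Ω) (lam : Plaq P k → Fin P.d) (hlam : ∀ Q j, ¬ (j = Q.μ ∨ j = Q.ν) ↔ j = lam Q)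
    (hσA : ∀ Q, (∃ s, MissingAhead Ω Q s) → MissingAhead Ω Q (σ Q))
    (hσB : ∀ Q, (¬ ∃ s, MissingAhead Ω Q s) → (∃ s, MissingBehind Ω Q s) → MissingBehind Ω Q (σ Q))
    (h2r : 2 * r + 1 ≤ Rt) (hRt : Rt + 2 ≤ P.L ^ k) (hN : 2 * max Rt (P.L ^ k / 2) + 1 ≤ P.sitesPerDir 0)
    (hF : ∀ Q : Plaq P k, Q ∈ plaqsIn k Ω → expSU (Fp Q) = V ⟨Q.src, Q.ν⟩ * V ⟨Q.src.shift Q.ν, Q.μ⟩ * (V ⟨Q.src.shift Q.μ, Q.ν⟩)⁻¹ * (V ⟨Q.src, Q.μ⟩)⁻¹)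
    (hTop : ∀ Q : Plaq P k, Q ∈ plaqsIn k Ω → (∀ s, CellIn Ω k ((cellOf Q s).shift (lam Q))) → ∀ q, C q →
      (∃ u, InTube Q.μ Q.ν Rt (P.L ^ k / 2) u ∧ u (lam Q) = (P.L ^ k / 2 : ℕ) ∧ q.src = boxSite (cornerSite k Q.src Q.μ Q.ν) u ∧ (q.μ = lam Q ∨ q.ν = lam Q)) →
      Plaq.Deep IsBall InBall q)
    (hBot : ∀ Q : Plaq P k, Q ∈ plaqsIn k Ω → (∀ s, CellIn Ω k (unshift (cellOf Q s) (lam Q))) → ∀ q, C q →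
      (∃ u, InTube Q.μ Q.ν Rt (P.L ^ k / 2) u ∧ u (lam Q) = -((P.L ^ k / 2 : ℕ) : ℤ) ∧ q.src.shift (lam Q) = boxSite (cornerSite k Q.src Q.μ Q.ν) u ∧
        (q.μ = lam Q ∨ q.ν = lam Q)) → Plaq.Deep IsBall InBall q) :
    ∀ Q, Q ∈ plaqsIn k Ω → ∀ q, C q → ¬ Plaq.Deep IsBall InBall q →
      (∃ b, Plaq.HasBond q b ∧ TubeActive V Rt Fp (fun Q => stringInd Q.μ Q.ν + betaQB r (σ Q).1 (σ Q).2 Q.μ Q.ν) (· ∈ plaqsIn k Ω) Q b) →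
      ∃ u : Fin P.d → ℤ, q.src = boxSite (cornerSite k Q.src Q.μ Q.ν) u ∧ InTube Q.μ Q.ν Rt (P.L ^ k / 2) u ∧ InTube Q.μ Q.ν Rt (P.L ^ k / 2) (u + e q.μ) ∧
        InTube Q.μ Q.ν Rt (P.L ^ k / 2) (u + e q.ν) ∧ InTube Q.μ Q.ν Rt (P.L ^ k / 2) (u + e q.μ + e q.ν) := by
  have hk : k ≤ P.m + P.K := (Nat.le_succ k).trans hk1
  intro Q hQ q hCq hnd ⟨b, hqb, hact⟩
  have hμν : Q.μ ≠ Q.ν := ne_of_lt Q.hμν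
  have hneq : q.μ ≠ q.ν := ne_of_lt q.hμν
  have hq := hC q hCq
  obtain ⟨c1, c2, c3, c4⟩ := corners_of_mem_plaqsIn hq
  have hi : ¬ (lam Q = Q.μ ∨ lam Q = Q.ν) := (hlam Q (lam Q)).mpr rfl
  have hd3 : ∀ j, ¬ (j = Q.μ ∨ j = Q.ν) → j = lam Q := fun j hj => (hlam Q j).mp hj
  -- chart of the active bond
  obtain ⟨w, hwT, hwT', hbw, hts⟩ := exists_chart_of_tubeActive V Rt Fp _ _ hk hRt hN (hF Q hQ) hact
  have hβ : betaQB r (σ Q).1 (σ Q).2 Q.μ Q.ν w b.dir ≠ 0 := by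
    intro h0; apply hts
    show (stringInd Q.μ Q.ν + betaQB r (σ Q).1 (σ Q).2 Q.μ Q.ν) w b.dir = _
    rw [Pi.add_apply, Pi.add_apply, h0, add_zero]
  obtain ⟨hwμ, hwν⟩ := betaQB_window r _ _ Q.μ Q.ν hβ
  obtain ⟨hdir, hquad⟩ := betaQB_touches r _ _ Q.μ Q.ν hμν hβ
  -- the quadrant endpoint `p ∈ {w, w + e_dir}`: in the box, on the side `σ Q`, same longitudinal coordinate as `w`
  obtain ⟨p, hpT, hpside, hpi, hpsrc⟩ : ∃ p : Fin P.d → ℤ, InTube Q.μ Q.ν Rt (P.L ^ k / 2) p ∧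
      ((if (σ Q).1 then p Q.μ ≤ 0 else 1 ≤ p Q.μ) ∧ (if (σ Q).2 then p Q.ν ≤ 0 else 1 ≤ p Q.ν)) ∧ p (lam Q) = w (lam Q) ∧
      (boxSite (cornerSite k Q.src Q.μ Q.ν) p = b.src ∨ boxSite (cornerSite k Q.src Q.μ Q.ν) p = b.src.shift b.dir) := by
    rcases hquad with hq' | hq'
    · exact ⟨w, hwT, hq', rfl, Or.inl hbw⟩
    · refine ⟨w + e b.dir, hwT', hq', ?_, Or.inr (by rw [boxSite_add_e, hbw])⟩
      have hne : lam Q ≠ b.dir := by intro h; rw [← h] at hdir; exact hi hdir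
      rw [add_e_apply_ne _ hne]
  -- bookkeeping
  have hwL : ∀ j, ¬ (j = Q.μ ∨ j = Q.ν) → |w j| ≤ ((P.L ^ k / 2 : ℕ) : ℤ) := fun j hj => hwT.abs_le_of_not_mem hj
  have hwTr : ∀ j, (j = Q.μ ∨ j = Q.ν) → |w j| ≤ 2 * (r : ℤ) := fun j hj => by rcases hj with rfl | rfl <;> assumption
  have h2r' : (2 * (r : ℤ) + 1) ≤ (Rt : ℤ) := by exact_mod_cast h2r
  have mk : ∀ v : Fin P.d → ℤ, (∀ j, (j = Q.μ ∨ j = Q.ν) → |v j - w j| ≤ 1) → (∀ j, ¬ (j = Q.μ ∨ j = Q.ν) → |v j| ≤ ((P.L ^ k / 2 : ℕ) : ℤ)) →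
      InTube Q.μ Q.ν Rt (P.L ^ k / 2) v := by
    intro v hvT hvL
    refine inTube_mk (fun j hj => ?_) hvL
    have h1 := hvT j hj; have h2 := hwTr j hj
    rw [abs_le] at h1 h2 ⊢; constructor <;> linarith
  have he0 : ∀ a : Fin P.d, (a = Q.μ ∨ a = Q.ν) → e a (lam Q) = (0 : ℤ) := fun a ha => by
    rw [ModelBox.e, Pi.single_apply, if_neg]; intro h; rw [h] at hi; exact hi ha
  have heii : e (lam Q) (lam Q) = (1 : ℤ) := by simp [ModelBox.e]
  have hwi := hwL (lam Q) hi
  rw [abs_le] at hwi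
  rcases hqb with hb | hb | hb | hb
  · -- case 1: `b = ⟨q.src, q.μ⟩`; the other direction of `q` is `q.ν`; `u := w`
    have hbs : b.src = q.src := by rw [hb]
    have hbd : b.dir = q.μ := by rw [hb]
    rw [hbd] at hdir hwT' hpsrc; rw [hbs] at hbw hpsrc
    by_cases hν : q.ν = Q.μ ∨ q.ν = Q.ν
    · refine ⟨w, hbw.symm, hwT, hwT', mk _ (fun j _ => ?_) (fun j hj => ?_), mk _ (fun j _ => ?_) (fun j hj => ?_)⟩
      · rw [show (w + e q.ν) j - w j = e q.ν j by simp only [Pi.add_apply]; ring]; exact abs_e_le _ _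
      · rw [hd3 j hj, Pi.add_apply, he0 _ hν, add_zero]; exact hwL _ hi
      · rw [show (w + e q.μ + e q.ν) j - w j = e q.μ j + e q.ν j by simp only [Pi.add_apply]; ring]; exact abs_e_add_e_le hneq _
      · rw [hd3 j hj, Pi.add_apply, Pi.add_apply, he0 _ hdir, he0 _ hν, add_zero, add_zero]; exact hwL _ hi
    · have hνi : q.ν = lam Q := hd3 q.ν hν
      by_cases hlt : w (lam Q) < ((P.L ^ k / 2 : ℕ) : ℤ)
      · refine ⟨w, hbw.symm, hwT, hwT', mk _ (fun j _ => ?_) (fun j hj => ?_), mk _ (fun j _ => ?_) (fun j hj => ?_)⟩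
        · rw [show (w + e q.ν) j - w j = e q.ν j by simp only [Pi.add_apply]; ring]; exact abs_e_le _ _
        · rw [hd3 j hj, Pi.add_apply, hνi, heii, abs_le]; constructor <;> linarith
        · rw [show (w + e q.μ + e q.ν) j - w j = e q.μ j + e q.ν j by simp only [Pi.add_apply]; ring]; exact abs_e_add_e_le hneq _
        · rw [hd3 j hj, Pi.add_apply, Pi.add_apply, he0 _ hdir, hνi, heii, abs_le]; constructor <;> linarith
      · -- top overflow: contradiction
        exfalso
        have hwi' : w (lam Q) = ((P.L ^ k / 2 : ℕ) : ℤ) := by omega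
        refine no_top_overflow hk Ω hsat htf σ Q hRt hpT hpside hi hd3 (hσA Q) (by rw [hpi, hwi']) ?_ ?_
        · rcases hpsrc with hps | hps
          · rw [hps, ← hνi]; exact c3
          · rw [hps, ← hνi]; exact c4
        · intro hall
          exact hnd (hTop Q hQ hall q hCq ⟨w, hwT, hwi', hbw.symm, Or.inr hνi⟩)
  · -- case 2: `b = ⟨q.src + e_{q.μ}, q.ν⟩`; `u := w − e_{q.μ}`
    have hbs : b.src = q.src.shift q.μ := by rw [hb]
    have hbd : b.dir = q.ν := by rw [hb]
    rw [hbd] at hdir hwT' hpsrc; rw [hbs] at hbw hpsrc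
    have hsrc : boxSite (cornerSite k Q.src Q.μ Q.ν) (w - e q.μ) = q.src := by
      have h1 : (boxSite (cornerSite k Q.src Q.μ Q.ν) (w - e q.μ)).shift q.μ = q.src.shift q.μ := by rw [← boxSite_add_e, sub_add_cancel, hbw]
      simpa only [unshift_shift] using congrArg (fun z => unshift z q.μ) h1
    have e4 : w - e q.μ + e q.μ + e q.ν = w + e q.ν := by rw [sub_add_cancel]
    by_cases hμ : q.μ = Q.μ ∨ q.μ = Q.ν
    · refine ⟨w - e q.μ, hsrc.symm, mk _ (fun j _ => ?_) (fun j hj => ?_), by rw [sub_add_cancel]; exact hwT, mk _ (fun j _ => ?_) (fun j hj => ?_),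
        by rw [e4]; exact hwT'⟩
      · rw [show (w - e q.μ) j - w j = -(e q.μ j) by simp only [Pi.sub_apply]; ring, abs_neg]; exact abs_e_le _ _
      · rw [hd3 j hj, Pi.sub_apply, he0 _ hμ, sub_zero]; exact hwL _ hi
      · rw [show (w - e q.μ + e q.ν) j - w j = e q.ν j - e q.μ j by simp only [Pi.add_apply, Pi.sub_apply]; ring]; exact abs_e_sub_e_le _ _ _
      · rw [hd3 j hj, Pi.add_apply, Pi.sub_apply, he0 _ hμ, he0 _ hdir, sub_zero, add_zero]; exact hwL _ hi
    · have hμi : q.μ = lam Q := hd3 q.μ hμ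
      by_cases hlt : -((P.L ^ k / 2 : ℕ) : ℤ) < w (lam Q)
      · refine ⟨w - e q.μ, hsrc.symm, mk _ (fun j _ => ?_) (fun j hj => ?_), by rw [sub_add_cancel]; exact hwT, mk _ (fun j _ => ?_) (fun j hj => ?_),
          by rw [e4]; exact hwT'⟩
        · rw [show (w - e q.μ) j - w j = -(e q.μ j) by simp only [Pi.sub_apply]; ring, abs_neg]; exact abs_e_le _ _
        · rw [hd3 j hj, Pi.sub_apply, hμi, heii, abs_le]; constructor <;> linarith
        · rw [show (w - e q.μ + e q.ν) j - w j = e q.ν j - e q.μ j by simp only [Pi.add_apply, Pi.sub_apply]; ring]; exact abs_e_sub_e_le _ _ _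
        · rw [hd3 j hj, Pi.add_apply, Pi.sub_apply, hμi, heii, he0 _ hdir, add_zero, abs_le]; constructor <;> linarith
      · -- bottom overflow: contradiction
        exfalso
        have hwi' : w (lam Q) = -((P.L ^ k / 2 : ℕ) : ℤ) := by omega
        refine no_bot_overflow hk Ω hsat htf σ Q hQ hRt hpT hpside hi hd3 hk1 hsat1 (hσB Q) (by rw [hpi, hwi']) ?_ ?_
        · rcases hpsrc with hps | hps
          · rw [hps, hμi, unshift_shift]; exact c1
          · rw [hps, hμi, shift_shift_comm, unshift_shift]; exact c3
        · intro hall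
          exact hnd (hBot Q hQ hall q hCq ⟨w, hwT, hwi', by rw [hbw, hμi], Or.inl hμi⟩)
  · -- case 3: `b = ⟨q.src + e_{q.ν}, q.μ⟩`; `u := w − e_{q.ν}`
    have hbs : b.src = q.src.shift q.ν := by rw [hb]
    have hbd : b.dir = q.μ := by rw [hb]
    rw [hbd] at hdir hwT' hpsrc; rw [hbs] at hbw hpsrc
    have hsrc : boxSite (cornerSite k Q.src Q.μ Q.ν) (w - e q.ν) = q.src := by
      have h1 : (boxSite (cornerSite k Q.src Q.μ Q.ν) (w - e q.ν)).shift q.ν = q.src.shift q.ν := by rw [← boxSite_add_e, sub_add_cancel, hbw]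
      simpa only [unshift_shift] using congrArg (fun z => unshift z q.ν) h1
    have e4 : w - e q.ν + e q.μ + e q.ν = w + e q.μ := by abel
    by_cases hν : q.ν = Q.μ ∨ q.ν = Q.ν
    · refine ⟨w - e q.ν, hsrc.symm, mk _ (fun j _ => ?_) (fun j hj => ?_), mk _ (fun j _ => ?_) (fun j hj => ?_), by rw [sub_add_cancel]; exact hwT,
        by rw [e4]; exact hwT'⟩
      · rw [show (w - e q.ν) j - w j = -(e q.ν j) by simp only [Pi.sub_apply]; ring, abs_neg]; exact abs_e_le _ _
      · rw [hd3 j hj, Pi.sub_apply, he0 _ hν, sub_zero]; exact hwL _ hi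
      · rw [show (w - e q.ν + e q.μ) j - w j = e q.μ j - e q.ν j by simp only [Pi.add_apply, Pi.sub_apply]; ring]; exact abs_e_sub_e_le _ _ _
      · rw [hd3 j hj, Pi.add_apply, Pi.sub_apply, he0 _ hν, he0 _ hdir, sub_zero, add_zero]; exact hwL _ hi
    · have hνi : q.ν = lam Q := hd3 q.ν hν
      by_cases hlt : -((P.L ^ k / 2 : ℕ) : ℤ) < w (lam Q)
      · refine ⟨w - e q.ν, hsrc.symm, mk _ (fun j _ => ?_) (fun j hj => ?_), mk _ (fun j _ => ?_) (fun j hj => ?_), by rw [sub_add_cancel]; exact hwT,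
          by rw [e4]; exact hwT'⟩
        · rw [show (w - e q.ν) j - w j = -(e q.ν j) by simp only [Pi.sub_apply]; ring, abs_neg]; exact abs_e_le _ _
        · rw [hd3 j hj, Pi.sub_apply, hνi, heii, abs_le]; constructor <;> linarith
        · rw [show (w - e q.ν + e q.μ) j - w j = e q.μ j - e q.ν j by simp only [Pi.add_apply, Pi.sub_apply]; ring]; exact abs_e_sub_e_le _ _ _
        · rw [hd3 j hj, Pi.add_apply, Pi.sub_apply, hνi, heii, he0 _ hdir, add_zero, abs_le]; constructor <;> linarith
      · exfalso
        have hwi' : w (lam Q) = -((P.L ^ k / 2 : ℕ) : ℤ) := by omega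
        refine no_bot_overflow hk Ω hsat htf σ Q hQ hRt hpT hpside hi hd3 hk1 hsat1 (hσB Q) (by rw [hpi, hwi']) ?_ ?_
        · rcases hpsrc with hps | hps
          · rw [hps, hνi, unshift_shift]; exact c1
          · rw [hps, hνi, shift_shift_comm, unshift_shift]; exact c2
        · intro hall
          exact hnd (hBot Q hQ hall q hCq ⟨w, hwT, hwi', by rw [hbw, hνi], Or.inr hνi⟩)
  · -- case 4: `b = ⟨q.src, q.ν⟩`; the other direction of `q` is `q.μ`; `u := w`
    have hbs : b.src = q.src := by rw [hb]
    have hbd : b.dir = q.ν := by rw [hb]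
    rw [hbd] at hdir hwT' hpsrc; rw [hbs] at hbw hpsrc
    have e4 : w + e q.μ + e q.ν = w + e q.ν + e q.μ := by abel
    by_cases hμ : q.μ = Q.μ ∨ q.μ = Q.ν
    · refine ⟨w, hbw.symm, hwT, mk _ (fun j _ => ?_) (fun j hj => ?_), hwT', mk _ (fun j _ => ?_) (fun j hj => ?_)⟩
      · rw [show (w + e q.μ) j - w j = e q.μ j by simp only [Pi.add_apply]; ring]; exact abs_e_le _ _
      · rw [hd3 j hj, Pi.add_apply, he0 _ hμ, add_zero]; exact hwL _ hi
      · rw [show (w + e q.μ + e q.ν) j - w j = e q.μ j + e q.ν j by simp only [Pi.add_apply]; ring]; exact abs_e_add_e_le hneq _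
      · rw [hd3 j hj, Pi.add_apply, Pi.add_apply, he0 _ hμ, he0 _ hdir, add_zero, add_zero]; exact hwL _ hi
    · have hμi : q.μ = lam Q := hd3 q.μ hμ
      by_cases hlt : w (lam Q) < ((P.L ^ k / 2 : ℕ) : ℤ)
      · refine ⟨w, hbw.symm, hwT, mk _ (fun j _ => ?_) (fun j hj => ?_), hwT', mk _ (fun j _ => ?_) (fun j hj => ?_)⟩
        · rw [show (w + e q.μ) j - w j = e q.μ j by simp only [Pi.add_apply]; ring]; exact abs_e_le _ _
        · rw [hd3 j hj, Pi.add_apply, hμi, heii, abs_le]; constructor <;> linarith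
        · rw [show (w + e q.μ + e q.ν) j - w j = e q.μ j + e q.ν j by simp only [Pi.add_apply]; ring]; exact abs_e_add_e_le hneq _
        · rw [hd3 j hj, Pi.add_apply, Pi.add_apply, hμi, heii, he0 _ hdir, add_zero, abs_le]; constructor <;> linarith
      · exfalso
        have hwi' : w (lam Q) = ((P.L ^ k / 2 : ℕ) : ℤ) := by omega
        refine no_top_overflow hk Ω hsat htf σ Q hRt hpT hpside hi hd3 (hσA Q) (by rw [hpi, hwi']) ?_ ?_
        · rcases hpsrc with hps | hps
          · rw [hps, ← hμi]; exact c2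
          · rw [hps, ← hμi, shift_shift_comm]; exact c4
        · intro hall
          exact hnd (hTop Q hQ hall q hCq ⟨w, hwT, hwi', hbw.symm, Or.inl hμi⟩)

/-- **★★ (A3 = hbox) FOR THE CANONICAL SYSTEM** of `…v3StartSystem` (`tfOf k Ω`, `IsTubeΩ k Ω`, `FpOf k V`, `RtT`; rule `quadOf Ω` via `missingAhead_quadOf`∕`missingBehind_quadOf`): region binders
`16 ≤ L^k`, `4·L^k ≤ N₀`, saturation at levels `k`, `k+1`; field binder: the log window on the tubes; ball binders `hTop`∕`hBot` at radius `RtT`. [cite: Balaban1985Variational, (11)–(14) pp.279–280] -/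
theorem hbox_startSys (hk1 : k + 1 ≤ P.m + P.K) (Ω : Set (Site P 0)) (hsat : ∀ x x' : Site P 0, coarsen k x = coarsen k x' → (x ∈ Ω ↔ x' ∈ Ω))
    (htf : ∀ z : Site P k, coarsen k (toFine k z) = z) (hsat1 : ∀ z z' : Site P k, blockOf z = blockOf z' → (CellIn Ω k z ↔ CellIn Ω k z'))
    (hC : ∀ q, C q → q ∈ plaqsIn 0 Ω) (lam : Plaq P k → Fin P.d) (hlam : ∀ Q j, ¬ (j = Q.μ ∨ j = Q.ν) ↔ j = lam Q)
    (hL : 16 ≤ P.L ^ k) (hN : 4 * P.L ^ k ≤ P.sitesPerDir 0)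
    (hwin : ∀ Q : Plaq P k, Q ∈ plaqsIn k Ω → ‖((wordQ k V Q : Matrix.specialUnitaryGroup n ℂ) : Matrix n n ℂ) - 1‖ ≤ 1 / 4 ∧
      (Fintype.card n : ℝ) * ‖((wordQ k V Q : Matrix.specialUnitaryGroup n ℂ) : Matrix n n ℂ) - 1‖ < Real.pi)
    (hTop : ∀ Q : Plaq P k, Q ∈ plaqsIn k Ω → (∀ s, CellIn Ω k ((cellOf Q s).shift (lam Q))) → ∀ q, C q →
      (∃ u, InTube Q.μ Q.ν (RtT P k) (P.L ^ k / 2) u ∧ u (lam Q) = (P.L ^ k / 2 : ℕ) ∧ q.src = boxSite (cornerSite k Q.src Q.μ Q.ν) u ∧ (q.μ = lam Q ∨ q.ν = lam Q)) →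
      Plaq.Deep IsBall InBall q)
    (hBot : ∀ Q : Plaq P k, Q ∈ plaqsIn k Ω → (∀ s, CellIn Ω k (unshift (cellOf Q s) (lam Q))) → ∀ q, C q →
      (∃ u, InTube Q.μ Q.ν (RtT P k) (P.L ^ k / 2) u ∧ u (lam Q) = -((P.L ^ k / 2 : ℕ) : ℤ) ∧ q.src.shift (lam Q) = boxSite (cornerSite k Q.src Q.μ Q.ν) u ∧
        (q.μ = lam Q ∨ q.ν = lam Q)) → Plaq.Deep IsBall InBall q) :
    ∀ Q, IsTubeΩ k Ω Q → ∀ q, C q → ¬ Plaq.Deep IsBall InBall q → (∃ b, Plaq.HasBond q b ∧ TubeActive V (RtT P k) (FpOf k V) (tfOf k Ω) (IsTubeΩ k Ω) Q b) →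
      ∃ u : Fin P.d → ℤ, q.src = boxSite (cornerSite k Q.src Q.μ Q.ν) u ∧ InTube Q.μ Q.ν (RtT P k) (P.L ^ k / 2) u ∧
        InTube Q.μ Q.ν (RtT P k) (P.L ^ k / 2) (u + e q.μ) ∧ InTube Q.μ Q.ν (RtT P k) (P.L ^ k / 2) (u + e q.ν) ∧
        InTube Q.μ Q.ν (RtT P k) (P.L ^ k / 2) (u + e q.μ + e q.ν) := by
  have h2r : 2 * rT P k + 1 ≤ RtT P k := by unfold RtT; omega
  have hRt : RtT P k + 2 ≤ P.L ^ k := by unfold RtT rT; omega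
  have hN' : 2 * max (RtT P k) (P.L ^ k / 2) + 1 ≤ P.sitesPerDir 0 := by
    have : max (RtT P k) (P.L ^ k / 2) ≤ P.L ^ k / 2 := max_le (by unfold RtT rT; omega) le_rfl
    omega
  have hF : ∀ Q : Plaq P k, Q ∈ plaqsIn k Ω → expSU (FpOf k V Q) = V ⟨Q.src, Q.ν⟩ * V ⟨Q.src.shift Q.ν, Q.μ⟩ * (V ⟨Q.src.shift Q.μ, Q.ν⟩)⁻¹ * (V ⟨Q.src, Q.μ⟩)⁻¹ :=
    fun Q hQ => expSU_FpOf k V Q (hwin Q hQ)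
  exact hbox_of_corners (fun Q => quadOf Ω Q) (rT P k) V (RtT P k) (FpOf k V) IsBall InBall C hk1 Ω hsat htf hsat1 hC lam hlam
    (fun Q h => missingAhead_quadOf Ω h) (fun Q h h' => missingBehind_quadOf Ω h h') h2r hRt hN' hF hTop hBot

end Box

end Summit.QuantumFields.YangMills.Theorems.TubeStart

end
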